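import Mathlib
import Summits.CriticalPhenomena.CardyFormulaZ2.Theorems.CardySelfRefinementDefs
import Summits.CriticalPhenomena.CardyFormulaZ2.Theorems.CardySelfRefinementGradientComparabilityStubSlopeBoundsCornerTransfer3Ring
import HarnessLib

/-!
# Crux `GradientComparability` (stmt-CriticalPhenomena-10269), line `monotone-product-coordinates` —
# stub `stub_cornerLocalSlope` (LOC), corner transfer (B″₃), part 2: the pointwise corner
# transfer for `k = 3` — a pivotal interior edge makes a side bundle set-pivotal after tying at
# most three sides

Route `CardySelfRefinement`, sub-problem `CriticalPhenomena/CardyFormulaZ2`; vocabulary from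
`CardySelfRefinementDefs` (`ax tb Aloc edgeOf`); part 1 (`…StubSlopeBoundsCornerTransfer3Ring`:
the ring of the `k = 3` cell, walks inside the interior block, `exists_exit_of_isPivotal`), the
`k`-free core of the `k = 2` transfer (`…CornerTransferReroute`: `mem_Aloc_of_local_patch`,
`setPivotal_chain4`) and the dead-cluster lemma (`…CornerTransferDead`:
`exists_adj_notMem_of_isPivotal`).

## Mathematics

For `k = 3` the cell of base `z` has the interior block `I = 3z + {1,2}²` and the boundary ring
`R` (twelve sub-edges = the four side bundles `B₁ = S = (z,0)`, `B₂ = E = (z+e₀,1)`,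
`B₃ = N = (z+e₁,0)`, `B₄ = W = (z,1)`).  Let `e = {x, μ}` be a lattice edge at an interior vertex
`x ∈ I` (every non-axial edge of the cell is of this form), pivotal for the localised joint
crossing event `Aloc m F η` in `ω`, the drawn `x` at distance `≥ r ≥ 20η` from every quad side.
Put `ω₀ = ω ∖ {e}`, `ρ' = ω₀ ∪ B₁ ∪ B₂ ∪ B₃ ∪ B₄`, and let `T` be the `ω₀`-open lattice edges with
both ends in `I`.
**Claim: `ρ' ∈ Aloc`.**  By `mem_Aloc_of_local_patch` it suffices to find `L ⊆ ρ'` near `x`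
with connected drawing containing the drawn `x` and `μ`.
* If `μ` is `T`-reachable from `x`, `L` = the edges of a `T`-walk `x → μ` (no tying needed).
* Otherwise the `T`-cluster `C_x ∋ x` misses `μ`, is within sup-distance `1` of `x`, and is closed
  under `ω₀`-open edges inside `I`; by `exists_adj_notMem_of_isPivotal` an open edge `{x', y} ≠ e`
  leaves it, necessarily to a ring vertex `y ∉ I` (`exists_exit_of_isPivotal`,
  `exit_mem_ring_three`); `L_x` = walk `x → x'` plus `{x', y}` joins the drawn `x` to the ring.
  If `μ ∉ I`, `μ` is itself a ring vertex and `L = R ∪ L_x`.  If `μ ∈ I`, the same escape from the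
  `T`-cluster of `μ` (drawn `μ` is `(r − 3η)`-far, `r − 3η ≥ 8η`) gives `L_μ`, and
  `L = R ∪ L_x ∪ L_μ`.
Then `ω₀ ∉ Aloc` and the chain lemma `setPivotal_chain4` give the registered pointwise transfer
`exists_setPivotal_side_of_isPivotal_three`: for some `j ≤ 4`, `B_j` is set-pivotal at
`ω₀ ∪ B₁ ∪ ⋯ ∪ B_{j−1}` — no interior edge opened, no selector touched, any number of quads.
Part 3 turns it into `M(e pivotal) ≤ 4369/(1−c) · Σ_j M(PIV_{B_j})`.
-/

noncomputable section

namespace Summit.CriticalPhenomena.CardyFormulaZ2.Theorems.CardySelfRefinement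

open scoped Topology
open Filter Set MeasureTheory
open Literature.Probability.LatticeModels Literature.Probability.Percolation
open Literature.Probability.Percolation.QuadCrossing
open Summit.CriticalPhenomena.CardyFormulaZ2.Theses.CardySelfRefinement

/-! ## The pointwise corner transfer for `k = 3` -/

/-- **Pointwise corner transfer, `k = 3`** (registered helper of `stub_cornerLocalSlope`; the
deterministic chase of brick (B″₃)).  Let `x ∈ 3z + {1,2}²` be an interior vertex of the cell of
base `z`, `{x, μ}` a lattice edge, the drawn `x` at distance `≥ r ≥ 20η` from every side of every
quad, and `{x, μ}` pivotal for the localised joint crossing event `Aloc m F η` in `ω`.  Put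
`ω₀ = ω ∖ {xμ}` and let `B₁, B₂, B₃, B₄` be the side bundles `(z,0)`, `(z+e₀,1)`, `(z+e₁,0)`, `(z,1)`.
Then for some `j ≤ 4` the bundle `B_j` is set-pivotal at `ω₀ ∪ B₁ ∪ ⋯ ∪ B_{j−1}`:
`(ω₀ ∪ ⋯ ∪ B_{j−1}) ∪ B_j ∈ Aloc` and `(ω₀ ∪ ⋯ ∪ B_{j−1}) ∖ B_j ∉ Aloc`. -/
theorem exists_setPivotal_side_of_isPivotal_three : ∀ (k m : ℕ), k = 3 → ∀ (F : Fin m → Quad (Set.univ : Set ℂ)) (η r : ℝ), 0 < η → 20 * η ≤ r → ∀ (z x μ : Site 2) (ω : BondConfig (Site 2)), (∀ l, x l = (k : ℤ) * z l + 1 ∨ x l = (k : ℤ) * z l + 2) → (zdGraph 2).Adj x μ → (∀ (i : Fin m) (j : Fin 4), ∀ p ∈ (F i).side j, r ≤ dist ((η : ℂ) * squareLatticeEmbedding.z x) p) → IsPivotal (Aloc m F η) s(x, μ) ω → ((ω \ {s(x, μ)}) ∪ edgeOf '' {vd : Site 2 × Fin 2 | ax k vd ∧ tb k vd = z ∧ vd.2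 = 0} ∈ Aloc m F η ∧ (ω \ {s(x, μ)}) \ edgeOf '' {vd : Site 2 × Fin 2 | ax k vd ∧ tb k vd = z ∧ vd.2 = 0} ∉ Aloc m F η) ∨ ((ω \ {s(x, μ)}) ∪ edgeOf '' {vd : Site 2 × Fin 2 | ax k vd ∧ tb k vd = z ∧ vd.2 = 0} ∪ edgeOf '' {vd : Site 2 × Fin 2 | ax k vd ∧ tb k vd = z + Pi.single 0 1 ∧ vd.2 = 1} ∈ Aloc m F η ∧ ((ω \ {s(x, μ)}) ∪ edgeOf '' {vd : Site 2 × Fin 2 | ax k vd ∧ tb k vd = z ∧ vd.2 = 0}) \ edgeOf '' {vd : Site 2 × Fin 2 | ax k vd ∧ tb k vd = z + Pi.single 0 1 ∧ vd.2 = 1} ∉ Aloc m F η) ∨ ((ω \ {s(x, μ)}) ∪ edgeOf '' {vd : Site 2 × Fin 2 | ax k vd ∧ tb k vd = z ∧ vd.2 = 0} ∪ edgeOf '' {vd : Site 2 × Fin 2 | ax k vd ∧ tb k vd = z + Pi.single 0 1 ∧ vd.2 = 1} ∪ edgeOf '' {vd : Site 2 × Fin 2 | ax k vd ∧ tb k vd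 = z + Pi.single 1 1 ∧ vd.2 = 0} ∈ Aloc m F η ∧ ((ω \ {s(x, μ)}) ∪ edgeOf '' {vd : Site 2 × Fin 2 | ax k vd ∧ tb k vd = z ∧ vd.2 = 0} ∪ edgeOf '' {vd : Site 2 × Fin 2 | ax k vd ∧ tb k vd = z + Pi.single 0 1 ∧ vd.2 = 1}) \ edgeOf '' {vd : Site 2 × Fin 2 | ax k vd ∧ tb k vd = z + Pi.single 1 1 ∧ vd.2 = 0} ∉ Aloc m F η) ∨ ((ω \ {s(x, μ)}) ∪ edgeOf '' {vd : Site 2 × Fin 2 | ax k vd ∧ tb k vd = z ∧ vd.2 = 0} ∪ edgeOf '' {vd : Site 2 × Fin 2 | ax k vd ∧ tb k vd = z + Pi.single 0 1 ∧ vd.2 = 1} ∪ edgeOf '' {vd : Site 2 × Fin 2 | ax k vd ∧ tb k vd = z + Pi.single 1 1 ∧ vd.2 = 0} ∪ edgeOf '' {vd : Site 2 × Fin 2 | ax k vd ∧ tb k vd = z ∧ vd.2 = 1} ∈ Aloc m F η ∧ ((ω \ {s(x, μ)}) ∪ edgeOf '' {vd : Site 2 × Fin 2 | ax k vd ∧ tb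 k vd = z ∧ vd.2 = 0} ∪ edgeOf '' {vd : Site 2 × Fin 2 | ax k vd ∧ tb k vd = z + Pi.single 0 1 ∧ vd.2 = 1} ∪ edgeOf '' {vd : Site 2 × Fin 2 | ax k vd ∧ tb k vd = z + Pi.single 1 1 ∧ vd.2 = 0}) \ edgeOf '' {vd : Site 2 × Fin 2 | ax k vd ∧ tb k vd = z ∧ vd.2 = 1} ∉ Aloc m F η) := by
  intro k m hk F η r hη hηr z x μ ω hx hxμ hfar hpiv
  have hpiv' : insert s(x, μ) ω ∈ Aloc m F η ∧ ω \ {s(x, μ)} ∉ Aloc m F η := by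
    rcases hpiv with ⟨ha, hb⟩ | ⟨ha, hb⟩
    · exact ⟨ha, hb⟩
    · exact absurd (isUpperSet_Aloc m F η (Set.sdiff_subset.trans (Set.subset_insert _ ω)) ha) hb
  refine setPivotal_chain4 (isUpperSet_Aloc m F η) (ω \ {s(x, μ)}) _ _ _ _ hpiv'.2 ?_
  -- names
  set dd : ℝ := η * Real.sqrt 2 with hdd_def
  set BS : Set (Sym2 (Site 2)) := edgeOf '' {vd : Site 2 × Fin 2 | ax k vd ∧ tb k vd = z ∧ vd.2 = 0} with hBS
  set BE : Set (Sym2 (Site 2)) := edgeOf '' {vd : Site 2 × Fin 2 | ax k vd ∧ tb k vd = z + Pi.single 0 1 ∧ vd.2 = 1}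
    with hBE
  set BN : Set (Sym2 (Site 2)) := edgeOf '' {vd : Site 2 × Fin 2 | ax k vd ∧ tb k vd = z + Pi.single 1 1 ∧ vd.2 = 0}
    with hBN
  set BW : Set (Sym2 (Site 2)) := edgeOf '' {vd : Site 2 × Fin 2 | ax k vd ∧ tb k vd = z ∧ vd.2 = 1} with hBW
  set ρ' : BondConfig (Site 2) := ω \ {s(x, μ)} ∪ BS ∪ BE ∪ BN ∪ BW with hρ'
  have hω₀ : ω \ {s(x, μ)} ⊆ ρ' := fun f hf => Or.inl (Or.inl (Or.inl (Or.inl hf)))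
  -- the frame of the cell, the interior block, the open interior edges
  set V : ℤ → ℤ → Site 2 := fun a b => ![(k : ℤ) * z 0, (k : ℤ) * z 1] + a • ![1, 0] + b • ![0, 1] with hVdef
  have hV : ∀ a b, V a b = ![(k : ℤ) * z 0, (k : ℤ) * z 1] + a • ![1, 0] + b • ![0, 1] := fun a b => rfl
  set I : Set (Site 2) := {u | ∀ l, u l = (k : ℤ) * z l + 1 ∨ u l = (k : ℤ) * z l + 2} with hI
  have hxI : x ∈ I := hx
  set T : Set (Sym2 (Site 2)) := {f | ∃ a b : Site 2, f = s(a, b) ∧ (zdGraph 2).Adj a b ∧ a ∈ I ∧ b ∈ I ∧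
    s(a, b) ∈ ω ∧ s(a, b) ≠ s(x, μ)} with hT
  have hTE : T ⊆ (zdGraph 2).edgeSet := by
    rintro f ⟨a, b, rfl, hab, -, -, -, -⟩
    exact (SimpleGraph.mem_edgeSet _).2 hab
  have hTI : ∀ f ∈ T, ∀ u ∈ f, u ∈ I := by
    rintro f ⟨a, b, rfl, -, ha, hb, -, -⟩ u hu
    rcases Sym2.mem_iff.1 hu with rfl | rfl
    exacts [ha, hb]
  have hTρ : T ⊆ ρ' := by
    rintro f ⟨a, b, rfl, -, -, -, hω, hne⟩
    exact hω₀ ⟨hω, hne⟩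
  have hTin : ∀ a b : Site 2, (zdGraph 2).Adj a b → a ∈ I → b ∈ I → s(a, b) ∈ ω → s(a, b) ≠ s(x, μ) → s(a, b) ∈ T :=
    fun a b hab ha hb hω hne => ⟨a, b, rfl, hab, ha, hb, hω, hne⟩
  have hTin' : ∀ a b : Site 2, (zdGraph 2).Adj a b → a ∈ I → b ∈ I → s(a, b) ∈ ω → s(a, b) ≠ s(μ, x) → s(a, b) ∈ T :=
    fun a b hab ha hb hω hne => hTin a b hab ha hb hω (by rw [Sym2.eq_swap (a := x)]; exact hne)
  have hII : ∀ u ∈ I, ∀ u' ∈ I, ∀ l, |u l - u' l| ≤ 1 := fun u hu u' hu' l =>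
    interior_coord_sub_le_three hk z hu hu' l
  -- the ring
  set R : Set (Sym2 (Site 2)) := ({s(V 0 0, V 1 0), s(V 1 0, V 2 0), s(V 2 0, V 3 0), s(V 3 0, V 3 1),
      s(V 3 1, V 3 2), s(V 3 2, V 3 3), s(V 3 3, V 2 3), s(V 2 3, V 1 3), s(V 1 3, V 0 3), s(V 0 3, V 0 2),
      s(V 0 2, V 0 1), s(V 0 1, V 0 0)} : Set (Sym2 (Site 2))) with hR
  obtain ⟨hRconn, -, hRedge⟩ := ring_facts_three hV dd
  have hRρ : R ⊆ ρ' := by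
    obtain ⟨h00, h30, h03, h00'⟩ := ring_subedges_mem_three hk z hV 0 le_rfl (by norm_num)
    obtain ⟨h10, h31, h13, h01⟩ := ring_subedges_mem_three hk z hV 1 zero_le_one (by norm_num)
    obtain ⟨h20, h32, h23, h02⟩ := ring_subedges_mem_three hk z hV 2 zero_le_two le_rfl
    simp only [show (0 : ℤ) + 1 = 1 by norm_num, show (1 : ℤ) + 1 = 2 by norm_num,
      show (2 : ℤ) + 1 = 3 by norm_num] at h00 h30 h03 h00' h10 h31 h13 h01 h20 h32 h23 h02
    intro f hf
    simp only [hR, Set.mem_insert_iff, Set.mem_singleton_iff] at hf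
    rcases hf with rfl | rfl | rfl | rfl | rfl | rfl | rfl | rfl | rfl | rfl | rfl | rfl
    · exact Or.inl (Or.inl (Or.inl (Or.inr h00)))
    · exact Or.inl (Or.inl (Or.inl (Or.inr h10)))
    · exact Or.inl (Or.inl (Or.inl (Or.inr h20)))
    · exact Or.inl (Or.inl (Or.inr h30))
    · exact Or.inl (Or.inl (Or.inr h31))
    · exact Or.inl (Or.inl (Or.inr h32))
    · exact Or.inl (Or.inr (by rw [Sym2.eq_swap]; exact h23))
    · exact Or.inl (Or.inr (by rw [Sym2.eq_swap]; exact h13))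
    · exact Or.inl (Or.inr (by rw [Sym2.eq_swap]; exact h03))
    · exact Or.inr (by rw [Sym2.eq_swap]; exact h02)
    · exact Or.inr (by rw [Sym2.eq_swap]; exact h01)
    · exact Or.inr (by rw [Sym2.eq_swap]; exact h00')
  -- nearness to `x`
  have hnearI : ∀ a ∈ I, ∀ i, |a i - x i| ≤ 4 := fun a ha i => (hII a ha x hxI i).trans (by norm_num)
  have hnearR : ∀ f ∈ R, ∃ a b, f = s(a, b) ∧ (zdGraph 2).Adj a b ∧ ∀ i, |a i - x i| ≤ 4 := fun f hf => by
    obtain ⟨a, b, a', b', rfl, hadj, h0, h1, h2, h3⟩ := hRedge f hf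
    exact ⟨_, _, rfl, hadj, frame_three_near hk z hV hx a b h0 h1 h2 h3⟩
  -- the patch produced by a walk inside the block plus an exit edge
  have hpatch : ∀ {a b : Site 2} (p : (SimpleGraph.fromEdgeSet T).Walk a b) {y : Site 2}, (zdGraph 2).Adj b y →
      b ∈ I → s(b, y) ∈ ρ' →
      insert s(b, y) {f | f ∈ p.edges} ⊆ ρ' ∧
      (∀ f ∈ insert s(b, y) {f | f ∈ p.edges}, ∃ a' b', f = s(a', b') ∧ (zdGraph 2).Adj a' b' ∧ ∀ i, |a' i - x i| ≤ 4) ∧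
      IsPreconnected (openEdgeUnion dd (insert s(b, y) {f | f ∈ p.edges})) ∧
      meshPoint dd a ∈ openEdgeUnion dd (insert s(b, y) {f | f ∈ p.edges}) ∧
      meshPoint dd y ∈ openEdgeUnion dd (insert s(b, y) {f | f ∈ p.edges}) := by
    intro a b p y hby hb hρ
    obtain ⟨h1, h2, h3, h4⟩ := walk_patch_facts dd hTE p hby
    refine ⟨?_, ?_, h1, h2, h3⟩
    · rintro f (rfl | hf)
      exacts [hρ, hTρ (h4 hf)]
    · rintro f (rfl | hf)
      · exact ⟨b, y, rfl, hby, hnearI b hb⟩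
      · obtain ⟨a', b', rfl, hab, ha', -, -, -⟩ := h4 hf
        exact ⟨a', b', rfl, hab, hnearI a' ha'⟩
  -- reduction to a patch
  have hsub : insert s(x, μ) ω ⊆ ρ' ∪ {s(x, μ)} := by
    intro f hf
    rcases Set.mem_insert_iff.1 hf with rfl | hfω
    · exact Or.inr rfl
    · by_cases hfe : f = s(x, μ)
      · exact Or.inr hfe
      · exact Or.inl (hω₀ ⟨hfω, hfe⟩)
  have he : s(x, μ) ∉ ρ' := by
    rintro ((((⟨-, h⟩ | h) | h) | h) | h)
    · exact h rfl
    · exact interior_edge_notMem_bundleSet_three k hk z x hx μ _ _ h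
    · exact interior_edge_notMem_bundleSet_three k hk z x hx μ _ _ h
    · exact interior_edge_notMem_bundleSet_three k hk z x hx μ _ _ h
    · exact interior_edge_notMem_bundleSet_three k hk z x hx μ _ _ h
  suffices hL : ∃ L : BondConfig (Site 2), L ⊆ ρ' ∧
      (∀ f ∈ L, ∃ a b, f = s(a, b) ∧ (zdGraph 2).Adj a b ∧ ∀ i, |a i - x i| ≤ 4) ∧
      IsPreconnected (openEdgeUnion dd L) ∧ meshPoint dd x ∈ openEdgeUnion dd L ∧ meshPoint dd μ ∈ openEdgeUnion dd L by
    obtain ⟨L, h1, h2, h3, h4, h5⟩ := hL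
    exact mem_Aloc_of_local_patch m F hη hηr hxμ hfar hsub he h1 h2 h3 h4 h5 hpiv'.1
  by_cases hμx : (SimpleGraph.fromEdgeSet T).Reachable x μ
  · -- `μ` is reached from `x` inside the block: an open interior path
    obtain ⟨p⟩ := hμx
    obtain ⟨w, h, p', -⟩ := SimpleGraph.Walk.exists_eq_cons_of_ne hxμ.ne p
    have hxwT : s(x, w) ∈ T := ((SimpleGraph.fromEdgeSet_adj T).1 h).1
    have hxw : (zdGraph 2).Adj x w := (SimpleGraph.mem_edgeSet _).1 (hTE hxwT)
    have hwI : w ∈ I := hTI _ hxwT w (Sym2.mem_mk_right _ _)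
    obtain ⟨h1, h2, h3, h4, h5⟩ := hpatch p'.reverse hxw.symm hwI (by rw [Sym2.eq_swap]; exact hTρ hxwT)
    exact ⟨_, h1, h2, h3, h5, h4⟩
  · -- the open cluster of `x` inside the block misses `μ`: it escapes to the ring
    have hpivs : IsPivotal (Aloc m F η) s(μ, x) ω := by rw [Sym2.eq_swap]; exact hpiv
    obtain ⟨x', y, hxx', hx'I, hyI, hx'y, hyω, hyne⟩ := exists_exit_of_isPivotal m F hη (r := r) (by linarith)
      hII hTI hTin' hxμ.symm hxI (fun h => hμx h) hfar hpivs
    obtain ⟨p⟩ := hxx'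
    have hyρ : s(x', y) ∈ ρ' := hω₀ ⟨hyω, by rw [Sym2.eq_swap (a := x)]; exact hyne⟩
    obtain ⟨hx1, hx2, hx3, hx4, hx5⟩ := hpatch p hx'y hx'I hyρ
    have hyR : meshPoint dd y ∈ openEdgeUnion dd R := exit_mem_ring_three hk z hV dd hx'I hx'y hyI
    -- the ring plus the escape path of `x`
    have hRL : IsPreconnected (openEdgeUnion dd (R ∪ insert s(x', y) {f | f ∈ p.edges})) := by
      rw [openEdgeUnion_union]
      exact IsPreconnected.union (meshPoint dd y) hyR hx5 hRconn hx3
    have hRLsub : R ∪ insert s(x', y) {f | f ∈ p.edges} ⊆ ρ' := Set.union_subset hRρ hx1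
    have hRLnear : ∀ f ∈ R ∪ insert s(x', y) {f | f ∈ p.edges}, ∃ a b, f = s(a, b) ∧ (zdGraph 2).Adj a b ∧
        ∀ i, |a i - x i| ≤ 4 := by
      rintro f (hf | hf)
      exacts [hnearR f hf, hx2 f hf]
    have hxRL : meshPoint dd x ∈ openEdgeUnion dd (R ∪ insert s(x', y) {f | f ∈ p.edges}) :=
      openEdgeUnion_mono dd Set.subset_union_right hx4
    by_cases hμI : μ ∈ I
    · -- `μ` is interior too: its own open cluster escapes as well
      have hfarμ : ∀ (i : Fin m) (j : Fin 4), ∀ q ∈ (F i).side j,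
          r - 3 * η ≤ dist ((η : ℂ) * squareLatticeEmbedding.z μ) q := by
        intro i j q hq
        have h1 := hfar i j q hq
        have h2 := dist_z_le_of_adj hxμ η
        rw [abs_of_pos hη] at h2
        have h3 : Real.sqrt 2 ≤ 3 / 2 := by
          nlinarith [Real.sq_sqrt (show (0 : ℝ) ≤ 2 by norm_num), Real.sqrt_nonneg 2]
        have h4 := dist_triangle ((η : ℂ) * squareLatticeEmbedding.z x) ((η : ℂ) * squareLatticeEmbedding.z μ) q
        nlinarith
      obtain ⟨μ', y', hμμ', hμ'I, hy'I, hμ'y', hy'ω, hy'ne⟩ := exists_exit_of_isPivotal m F hη (r := r - 3 * η)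
        (by linarith) hII hTI hTin hxμ hμI (fun h => hμx h.symm) hfarμ hpiv
      obtain ⟨q⟩ := hμμ'
      have hy'ρ : s(μ', y') ∈ ρ' := hω₀ ⟨hy'ω, hy'ne⟩
      obtain ⟨hm1, hm2, hm3, hm4, hm5⟩ := hpatch q hμ'y' hμ'I hy'ρ
      have hy'R : meshPoint dd y' ∈ openEdgeUnion dd R := exit_mem_ring_three hk z hV dd hμ'I hμ'y' hy'I
      refine ⟨(R ∪ insert s(x', y) {f | f ∈ p.edges}) ∪ insert s(μ', y') {f | f ∈ q.edges},
        Set.union_subset hRLsub hm1, ?_, ?_, openEdgeUnion_mono dd Set.subset_union_left hxRL,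
        openEdgeUnion_mono dd Set.subset_union_right hm4⟩
      · rintro f (hf | hf)
        exacts [hRLnear f hf, hm2 f hf]
      · rw [openEdgeUnion_union]
        exact IsPreconnected.union (meshPoint dd y')
          (openEdgeUnion_mono dd Set.subset_union_left hy'R) hm5 hRL hm3
    · -- `μ` is a ring vertex
      have hμR : meshPoint dd μ ∈ openEdgeUnion dd R := exit_mem_ring_three hk z hV dd hx hxμ hμI
      exact ⟨R ∪ insert s(x', y) {f | f ∈ p.edges}, hRLsub, hRLnear, hRL, hxRL,
        openEdgeUnion_mono dd Set.subset_union_left hμR⟩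

end Summit.CriticalPhenomena.CardyFormulaZ2.Theorems.CardySelfRefinement

end
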